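import Mathlib
import Summits.Ventures.HodgeRepro2.Tier7.Line3.KappaPlaces

/-!
# Tier 7 — LINE 3 support: the two-torus invariant descends to the totally real field (`κ(γ) ∈ F`)
(`Line3/KappaDescent.lean`; t7-L1-p5, gen 2; closes t7-crit-2's record (1) on `KappaPlaces`, STATUS l. 15253)

`KappaPlaces.sigma_kappa` gives `σ (κ(γ)) = κ(γ)` in the CM field `E`. The `InfinitePlace` statements of `KappaPlaces` take
`κF : K` with `algebraMap K E κF = κ(γ)` as a hypothesis; this file supplies it for the actual situation: `E / F` a Galois
extension of degree 2 (the CM field over its totally real subfield) with `σ : E ≃ₐ[F] E` the non-trivial automorphism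
(`σ ≠ 1`), `d` σ-fixed. Then
* `exists_algebraMap_of_fixed_quadratic`: a σ-fixed element of `E` lies in the image of `F` (Galois descent:
  `Gal(E/F)` has order 2 = `Module.finrank F E`, so `zpowers σ = ⊤` and the stabiliser of `x` is everything;
  `IsGalois.fixedField_top`);
* `sigma_sigma`: `σ (σ x) = x` (an element of a group of order 2 is an involution);
* `exists_kappa_eq_algebraMap`: `∃ κF : F, algebraMap F E κF = kappa (σ : E →+* E) d f γ` — the displayed `hκ` of
  `KappaPlaces.infinitePlace_kappa_le_one` / `one_le_infinitePlace_kappa` / `infinitePlace_kappa_sub_le_one` holds with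
  `K = F`.
Nothing about the real group, periods or (N). Pure Galois theory (Mathlib) + algebra.
Sorry-free; axioms: propext / Classical.choice / Quot.sound. §8(d): uses an L-value-free non-vanishing device: NO.
-/

namespace Summit.Ventures.HodgeRepro2.Tier7.Line3.KappaDescent

open Summit.Ventures.HodgeRepro2.T7SupportTwoTorusInvariant Summit.Ventures.HodgeRepro2.Tier7.Line3.KappaPlaces

variable {F E : Type*} [Field F] [Field E] [Algebra F E]

/-- an element fixed by every `F`-automorphism of a finite Galois extension lies in `F` -/
theorem exists_algebraMap_of_forall_fixed [IsGalois F E] [FiniteDimensional F E] (x : E)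
    (hx : ∀ g : E ≃ₐ[F] E, g x = x) : ∃ y : F, algebraMap F E y = x := by
  have h : x ∈ IntermediateField.fixedField (⊤ : Subgroup (E ≃ₐ[F] E)) := by
    rw [IntermediateField.mem_fixedField_iff]
    intro g _
    exact hx g
  rw [IsGalois.fixedField_top] at h
  exact IntermediateField.mem_bot.1 h

/-- in a quadratic Galois extension the non-trivial automorphism generates the Galois group -/
theorem zpowers_eq_top_of_finrank_two [IsGalois F E] [FiniteDimensional F E]
    (hrank : Module.finrank F E = 2) (σ : E ≃ₐ[F] E) (hσ : σ ≠ 1) : Subgroup.zpowers σ = ⊤ := by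
  have hcard : Nat.card (E ≃ₐ[F] E) = 2 := by rw [IsGalois.card_aut_eq_finrank, hrank]
  have h2 : σ ^ 2 = 1 := by rw [← hcard]; exact pow_card_eq_one'
  haveI : Fact (Nat.Prime 2) := ⟨Nat.prime_two⟩
  have hord : orderOf σ = 2 := orderOf_eq_prime h2 hσ
  apply Subgroup.eq_top_of_card_eq
  rw [Nat.card_zpowers, hord, hcard]

/-- **Galois descent for a quadratic extension**: an element fixed by the non-trivial automorphism lies in `F` -/
theorem exists_algebraMap_of_fixed_quadratic [IsGalois F E] [FiniteDimensional F E]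
    (hrank : Module.finrank F E = 2) (σ : E ≃ₐ[F] E) (hσ : σ ≠ 1) (x : E) (hx : σ x = x) :
    ∃ y : F, algebraMap F E y = x := by
  apply exists_algebraMap_of_forall_fixed x
  intro g
  have hst : Subgroup.zpowers σ ≤ MulAction.stabilizer (E ≃ₐ[F] E) x := by
    rw [Subgroup.zpowers_le, MulAction.mem_stabilizer_iff]
    exact hx
  have hg : g ∈ MulAction.stabilizer (E ≃ₐ[F] E) x :=
    hst ((zpowers_eq_top_of_finrank_two hrank σ hσ) ▸ Subgroup.mem_top g)
  exact MulAction.mem_stabilizer_iff.1 hg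

/-- the non-trivial automorphism of a quadratic Galois extension is an involution -/
theorem sigma_sigma [IsGalois F E] [FiniteDimensional F E] (hrank : Module.finrank F E = 2)
    (σ : E ≃ₐ[F] E) (x : E) : σ (σ x) = x := by
  have hcard : Nat.card (E ≃ₐ[F] E) = 2 := by rw [IsGalois.card_aut_eq_finrank, hrank]
  have h2 : σ ^ 2 = 1 := by rw [← hcard]; exact pow_card_eq_one'
  have := congrArg (fun g : E ≃ₐ[F] E => g x) h2
  simpa [pow_two] using this

/-- **`κ(γ) ∈ F`**: the two-torus invariant of the CM field `E` with its conjugation `σ` and σ-fixed discriminants is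
the image of an element of the totally real field `F` -/
theorem exists_kappa_eq_algebraMap [IsGalois F E] [FiniteDimensional F E] (hrank : Module.finrank F E = 2)
    (σ : E ≃ₐ[F] E) (hσ : σ ≠ 1) (d : Fin 2 → E) (hd : ∀ i, σ (d i) = d i) (f : Fin 2 → Fin 2 → E)
    (γ : Matrix (Fin 2) (Fin 2) E) :
    ∃ κF : F, algebraMap F E κF = kappa (σ : E →+* E) d f γ := by
  apply exists_algebraMap_of_fixed_quadratic hrank σ hσ
  have hσ' : ∀ x, (σ : E →+* E) ((σ : E →+* E) x) = x := fun x => sigma_sigma hrank σ x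
  exact sigma_kappa (σ : E →+* E) hσ' d hd f γ

end Summit.Ventures.HodgeRepro2.Tier7.Line3.KappaDescent
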